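import Summits.ValiantsHypothesis.ValiantsHypothesis.Theorems.GrenetZeonDualUnipotentThreeHalvesHeavyTopHalfSpeed

/-!
# `GrenetZeon.DualUnipotentThreeHalves` (stmt-ValiantsHypothesis-24318), LINE β `half_speed`, stub K1 — the SEAM STEP's
# CODIMENSION BOOKKEEPING (second file of the first honest sub-case; desk #328 (a))

For the induction `HalfSpeedIrrLaw → HalfSpeedLaw` one glues certified diagonal constituents (✓ `halfSpeed_glue`, seam form ✓
`halfSpeed_of_blocks`) and must control the CODIMENSION of the glued certificate: with `T := {A ∈ U : A₁₁ ∈ T₁, A₂₂ ∈ T₂}`,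

  `codim_U T ≤ codim_{U₁} T₁ + codim_{U₂} T₂`   (rank–nullity for `U → (M₁ ⧸ T₁) × (M₂ ⧸ T₂)`),

stated subtraction-free as `finrank U + finrank T₁ + finrank T₂ ≤ finrank T + finrank U₁ + finrank U₂` (`Tᵢ ≤ Uᵢ`, `Uᵢ ⊇` the
diagonal blocks of `U`).  The block projections `Matrix.toBlocks₁₁/₂₂` are used through their (definitional) linearity (`toBlocks₁₁_linear`,
`toBlocks₂₂_linear`: existence of a linear map with those values — no new notion).
Honest framing: plumbing for a stub of LINE β; nothing here proves `HalfSpeedLaw`, `HalfSpeedIrrLaw`, `HeavyTopLaw`, 24318, S3b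
or 8062; `VP ≠ VNP` is not moved; no summit statement is proved here.  No definitions, no named facts. [β card K1; val-port-3 g2]
-/

noncomputable section

-- single-conjunct layout: Sub = Summit, duplicated namespace component intended
set_option linter.dupNamespace false

namespace Summit.ValiantsHypothesis.ValiantsHypothesis.Theorems.GrenetZeon.HalfSpeed

open Matrix

section Codim

variable {ι₁ ι₂ : Type*} [Fintype ι₁] [Fintype ι₂]

omit [Fintype ι₁] [Fintype ι₂] in
/-- `toBlocks₁₁` is additive and homogeneous (packaged as a linear map on the fly). -/
theorem toBlocks₁₁_linear :
    ∃ f : Matrix (ι₁ ⊕ ι₂) (ι₁ ⊕ ι₂) ℂ →ₗ[ℂ] Matrix ι₁ ι₁ ℂ, ∀ A, f A = A.toBlocks₁₁ :=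
  ⟨{ toFun := Matrix.toBlocks₁₁, map_add' := fun _ _ => rfl, map_smul' := fun _ _ => rfl }, fun _ => rfl⟩

omit [Fintype ι₁] [Fintype ι₂] in
/-- `toBlocks₂₂` is additive and homogeneous (packaged as a linear map on the fly). -/
theorem toBlocks₂₂_linear :
    ∃ f : Matrix (ι₁ ⊕ ι₂) (ι₁ ⊕ ι₂) ℂ →ₗ[ℂ] Matrix ι₂ ι₂ ℂ, ∀ A, f A = A.toBlocks₂₂ :=
  ⟨{ toFun := Matrix.toBlocks₂₂, map_add' := fun _ _ => rfl, map_smul' := fun _ _ => rfl }, fun _ => rfl⟩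

omit [Fintype ι₁] [Fintype ι₂] in
/-- Rank–nullity through a quotient: for `N ≤ p`, `finrank (p.map N.mkQ) + finrank N = finrank p`. [folklore] -/
theorem finrank_map_mkQ_add {M : Type*} [AddCommGroup M] [Module ℂ M] [FiniteDimensional ℂ M]
    (p N : Submodule ℂ M) (hN : N ≤ p) :
    Module.finrank ℂ (p.map N.mkQ) + Module.finrank ℂ N = Module.finrank ℂ p := by
  have hker : LinearMap.ker (N.mkQ ∘ₗ p.subtype) = Submodule.comap p.subtype N := by
    rw [LinearMap.ker_comp, Submodule.ker_mkQ]
  have hrange : LinearMap.range (N.mkQ ∘ₗ p.subtype) = p.map N.mkQ := by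
    rw [LinearMap.range_comp, Submodule.range_subtype]
  have h := LinearMap.finrank_range_add_finrank_ker (N.mkQ ∘ₗ p.subtype)
  rw [hrange, hker, LinearEquiv.finrank_eq (Submodule.comapSubtypeEquivOfLe hN)] at h
  exact h

/-- **SEAM CODIMENSION.**  Let `U` be a linear space of matrices over `ι₁ ⊕ ι₂` whose diagonal blocks lie in `U₁`, `U₂`,
and let `T₁ ≤ U₁`, `T₂ ≤ U₂`.  Then the subspace `T = {A ∈ U : A₁₁ ∈ T₁ ∧ A₂₂ ∈ T₂}` satisfies
`codim_U T ≤ codim_{U₁} T₁ + codim_{U₂} T₂`, i.e.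
`finrank U + finrank T₁ + finrank T₂ ≤ finrank T + finrank U₁ + finrank U₂`. [β card K1, seam bookkeeping] -/
theorem exists_seam_submodule (U : Submodule ℂ (Matrix (ι₁ ⊕ ι₂) (ι₁ ⊕ ι₂) ℂ))
    (U₁ T₁ : Submodule ℂ (Matrix ι₁ ι₁ ℂ)) (U₂ T₂ : Submodule ℂ (Matrix ι₂ ι₂ ℂ))
    (hU₁ : ∀ A ∈ U, A.toBlocks₁₁ ∈ U₁) (hU₂ : ∀ A ∈ U, A.toBlocks₂₂ ∈ U₂) (hT₁ : T₁ ≤ U₁) (hT₂ : T₂ ≤ U₂) :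
    ∃ T : Submodule ℂ (Matrix (ι₁ ⊕ ι₂) (ι₁ ⊕ ι₂) ℂ), T ≤ U ∧
      (∀ A, A ∈ T ↔ A ∈ U ∧ A.toBlocks₁₁ ∈ T₁ ∧ A.toBlocks₂₂ ∈ T₂) ∧
      Module.finrank ℂ U + Module.finrank ℂ T₁ + Module.finrank ℂ T₂ ≤
        Module.finrank ℂ T + Module.finrank ℂ U₁ + Module.finrank ℂ U₂ := by
  obtain ⟨b₁, hb₁⟩ := (toBlocks₁₁_linear : ∃ f : Matrix (ι₁ ⊕ ι₂) (ι₁ ⊕ ι₂) ℂ →ₗ[ℂ] Matrix ι₁ ι₁ ℂ, _)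
  obtain ⟨b₂, hb₂⟩ := (toBlocks₂₂_linear : ∃ f : Matrix (ι₁ ⊕ ι₂) (ι₁ ⊕ ι₂) ℂ →ₗ[ℂ] Matrix ι₂ ι₂ ℂ, _)
  -- the quotient map `q : U → (M₁ ⧸ T₁) × (M₂ ⧸ T₂)`
  let q : U →ₗ[ℂ] (Matrix ι₁ ι₁ ℂ ⧸ T₁) × (Matrix ι₂ ι₂ ℂ ⧸ T₂) :=
    LinearMap.prod (T₁.mkQ ∘ₗ b₁ ∘ₗ U.subtype) (T₂.mkQ ∘ₗ b₂ ∘ₗ U.subtype)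
  refine ⟨(LinearMap.ker q).map U.subtype, ?_, ?_, ?_⟩
  · intro A hA
    obtain ⟨x, -, rfl⟩ := Submodule.mem_map.1 hA
    exact x.2
  · intro A
    constructor
    · intro hA
      obtain ⟨x, hx, rfl⟩ := Submodule.mem_map.1 hA
      rw [LinearMap.mem_ker] at hx
      have h1 : T₁.mkQ (b₁ (x : Matrix (ι₁ ⊕ ι₂) (ι₁ ⊕ ι₂) ℂ)) = 0 := congrArg Prod.fst hx
      have h2 : T₂.mkQ (b₂ (x : Matrix (ι₁ ⊕ ι₂) (ι₁ ⊕ ι₂) ℂ)) = 0 := congrArg Prod.snd hx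
      rw [Submodule.mkQ_apply, Submodule.Quotient.mk_eq_zero] at h1 h2
      rw [hb₁] at h1; rw [hb₂] at h2
      exact ⟨x.2, h1, h2⟩
    · rintro ⟨hAU, h1, h2⟩
      refine Submodule.mem_map.2 ⟨⟨A, hAU⟩, ?_, rfl⟩
      rw [LinearMap.mem_ker]
      ext <;> simp [q, hb₁, hb₂, h1, h2]
  · -- rank–nullity for `q`, range inside `(U₁/T₁) × (U₂/T₂)`
    have hrn := LinearMap.finrank_range_add_finrank_ker q
    have hker : Module.finrank ℂ ((LinearMap.ker q).map U.subtype) = Module.finrank ℂ (LinearMap.ker q) :=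
      LinearEquiv.finrank_eq (Submodule.equivMapOfInjective _ U.injective_subtype _).symm
    have hrange : LinearMap.range q ≤ (U₁.map T₁.mkQ).prod (U₂.map T₂.mkQ) := by
      rintro _ ⟨x, rfl⟩
      refine ⟨Submodule.mem_map.2 ⟨b₁ x, ?_, rfl⟩, Submodule.mem_map.2 ⟨b₂ x, ?_, rfl⟩⟩
      · rw [hb₁]; exact hU₁ _ x.2
      · rw [hb₂]; exact hU₂ _ x.2
    have hle := Submodule.finrank_mono hrange
    have hprod : Module.finrank ℂ ((U₁.map T₁.mkQ).prod (U₂.map T₂.mkQ)) ≤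
        Module.finrank ℂ (U₁.map T₁.mkQ) + Module.finrank ℂ (U₂.map T₂.mkQ) := by
      rw [LinearMap.prod_eq_sup_map]
      refine (Submodule.finrank_add_le_finrank_add_finrank _ _).trans (le_of_eq ?_)
      rw [← LinearEquiv.finrank_eq (Submodule.equivMapOfInjective _ LinearMap.inl_injective _),
        ← LinearEquiv.finrank_eq (Submodule.equivMapOfInjective _ LinearMap.inr_injective _)]
    have h1 := finrank_map_mkQ_add U₁ T₁ hT₁
    have h2 := finrank_map_mkQ_add U₂ T₂ hT₂
    omega

end Codim

end Summit.ValiantsHypothesis.ValiantsHypothesis.Theorems.GrenetZeon.HalfSpeed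

end
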